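import Summits.MatrixMultiplication.MatrixMultiplication.Theorems.SubgroupIdentityDesigns.Negative.OppositeCorners

/-!
# The corner grid in `D = T₁T₂` kills level-1 identity designs (negative lemmas for the crux
# `SubgroupIdentityDesigns`, stmt-MatrixMultiplication-14079) — VALUE = THEOREM (all p), NOT
# summit progress; the crux stays open.

`OppositeCorners.lean` needs the decorations `diag(e,1)` and `diag(1,d)` inside the two members
themselves.  Here the hypothesis is weakened to the natural one: `K₁ ⊇ U⁺`, `K₂ ⊇ U⁻`, and the
three grid points `diag(e,1)`, `diag(1,d)`, `diag(e,d)` are PRODUCTS `a·b` with `a ∈ K₁`, `b ∈ K₂`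
(`e, d ∉ {0,1}`).  Reason: the corner cell `C(ε,δ) = U⁺·diag(ε,δ)·U⁻` (`exists_factor_cell`), so
`u⁺ diag(ε,δ) u⁻ = (u⁺a)(b u⁻) ∈ K₁·K₂`, and the corner annihilator of `OppositeCorners` is still
supported on `K₁·K₂`; pair independence (`PairIndependence`) does the rest.

For a Sylow frame `K₁ = U⁺T₁`, `K₂ = U⁻T₂` (`SylowFrames.exists_borel_frame_of_tpp`) this is exactly
the condition "`D = T₁T₂` meets BOTH coordinate kernels non-trivially"
(`∃ diag(1,d) ∈ D`, `∃ diag(e,1) ∈ D`, `d, e ≠ 1`) — e.g. `T₁ = ⟨diag(1,-1)⟩`, `T₂ = {±1}`: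
`diag(-1,1) = diag(1,-1)·(-1)` (`no_levelOne_design_mixed_frame`, crux vocabulary).  Six
placements (`no_idTest_grid_up₁_lo₂`, …), every prime `p`.
Honest scope: same-corner coprime decorations (`D ⊆ {diag(1,·)}`) are NOT covered — they are
level-1 independent as pairs (census, kit job j110283) and need the third member.
-/

set_option linter.dupNamespace false

noncomputable section

open scoped BigOperators Classical
open Summit.MatrixMultiplication.MatrixMultiplication.Theorems.LieRankDesigns.Negative
  (GLm Mat fourierFn)
open Summit.MatrixMultiplication.MatrixMultiplication.Theorems.LevelOneGL2Designs.Negative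
  (levelSubmodule)

namespace Summit.MatrixMultiplication.MatrixMultiplication.Theorems.SubgroupIdentityDesigns.Negative

section CornerGrid

open Literature.Barriers.MatrixMultiplication (SubgroupTPP)

variable {p : ℕ} [hp : Fact p.Prime]

/-- `C(ε,δ) = U⁺·diag(ε,δ)·U⁻`:
`[[ε + xy, xδ],[y, δ]] = [[1,x],[0,1]]·diag(ε,δ)·[[1,0],[y/δ,1]]`. -/
theorem exists_factor_cell {g : GLm p 2} {ε δ x y : ZMod p} (hε : ε ≠ 0) (hδ : δ ≠ 0)
    (h : (g : Mat p 2) = !![ε + x * y, x * δ; y, δ]) :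
    ∃ u t v : GLm p 2, g = u * t * v ∧
      (u : Mat p 2) 1 0 = 0 ∧ (u : Mat p 2) 0 0 = 1 ∧ (u : Mat p 2) 1 1 = 1 ∧
      (t : Mat p 2) = !![ε, 0; 0, δ] ∧
      (v : Mat p 2) 0 1 = 0 ∧ (v : Mat p 2) 0 0 = 1 ∧ (v : Mat p 2) 1 1 = 1 := by
  refine ⟨Matrix.GeneralLinearGroup.mkOfDetNeZero !![1, x; 0, 1]
      (by rw [Matrix.det_fin_two_of]; simp),
    Matrix.GeneralLinearGroup.mkOfDetNeZero !![ε, 0; 0, δ]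
      (by rw [Matrix.det_fin_two_of]; simpa using mul_ne_zero hε hδ),
    Matrix.GeneralLinearGroup.mkOfDetNeZero !![1, 0; y / δ, 1]
      (by rw [Matrix.det_fin_two_of]; simp), ?_, rfl, rfl, rfl, rfl, rfl, rfl, rfl⟩
  apply Units.ext
  rw [Units.val_mul, Units.val_mul, h]
  show !![ε + x * y, x * δ; y, δ] = !![1, x; 0, 1] * !![ε, 0; 0, δ] * !![1, 0; y / δ, 1]
  rw [Matrix.mul_fin_two, Matrix.mul_fin_two]
  ext i j
  fin_cases i <;> fin_cases j <;> simp [mul_div_cancel₀ _ hδ]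
  -- entry (0,0): `x * y = x * (δ * y) / δ`
  field_simp

/-- Reversed cells: `[[ε, x],[yε, xy + δ]] = [[1,0],[y,1]]·diag(ε,δ)·[[1, x/ε],[0, 1]]`. -/
theorem exists_factor_cell_rev {g : GLm p 2} {ε δ x y : ZMod p} (hε : ε ≠ 0) (hδ : δ ≠ 0)
    (h : (g : Mat p 2) = !![ε, x; y * ε, x * y + δ]) :
    ∃ v t u : GLm p 2, g = v * t * u ∧
      (v : Mat p 2) 0 1 = 0 ∧ (v : Mat p 2) 0 0 = 1 ∧ (v : Mat p 2) 1 1 = 1 ∧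
      (t : Mat p 2) = !![ε, 0; 0, δ] ∧
      (u : Mat p 2) 1 0 = 0 ∧ (u : Mat p 2) 0 0 = 1 ∧ (u : Mat p 2) 1 1 = 1 := by
  refine ⟨Matrix.GeneralLinearGroup.mkOfDetNeZero !![1, 0; y, 1]
      (by rw [Matrix.det_fin_two_of]; simp),
    Matrix.GeneralLinearGroup.mkOfDetNeZero !![ε, 0; 0, δ]
      (by rw [Matrix.det_fin_two_of]; simpa using mul_ne_zero hε hδ),
    Matrix.GeneralLinearGroup.mkOfDetNeZero !![1, x / ε; 0, 1]
      (by rw [Matrix.det_fin_two_of]; simp), ?_, rfl, rfl, rfl, rfl, rfl, rfl, rfl⟩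
  apply Units.ext
  rw [Units.val_mul, Units.val_mul, h]
  show !![ε, x; y * ε, x * y + δ] = !![1, 0; y, 1] * !![ε, 0; 0, δ] * !![1, x / ε; 0, 1]
  rw [Matrix.mul_fin_two, Matrix.mul_fin_two]
  ext i j
  fin_cases i <;> fin_cases j <;> simp [mul_div_cancel₀ _ hε, mul_comm]
  -- entry (1,1): `x * y = x / ε * (ε * y)`
  field_simp

/-- Product of an `[[ε, x],[0, 1]]`-type and a `[[1, 0],[y, δ]]`-type element is the corner-cell
matrix `[[ε + xy, xδ],[y, δ]]`. -/
theorem coe_mul_eq_corner {a b : GLm p 2} (ha10 : (a : Mat p 2) 1 0 = 0)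
    (ha11 : (a : Mat p 2) 1 1 = 1) (hb01 : (b : Mat p 2) 0 1 = 0) (hb00 : (b : Mat p 2) 0 0 = 1) :
    ((a * b : GLm p 2) : Mat p 2) =
      !![(a : Mat p 2) 0 0 + (a : Mat p 2) 0 1 * (b : Mat p 2) 1 0,
        (a : Mat p 2) 0 1 * (b : Mat p 2) 1 1; (b : Mat p 2) 1 0, (b : Mat p 2) 1 1] := by
  rw [Units.val_mul]
  ext i j
  fin_cases i <;> fin_cases j <;>
    simp [Matrix.mul_apply, Fin.sum_univ_two, ha10, ha11, hb01, hb00]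

/-- Product of a `[[1, 0],[y, δ]]`-type and an `[[ε, x],[0, 1]]`-type element is the reversed
corner-cell matrix `[[ε, x],[yε, xy + δ]]`. -/
theorem coe_mul_eq_corner_rev {b a : GLm p 2} (hb01 : (b : Mat p 2) 0 1 = 0)
    (hb00 : (b : Mat p 2) 0 0 = 1) (ha10 : (a : Mat p 2) 1 0 = 0) (ha11 : (a : Mat p 2) 1 1 = 1) :
    ((b * a : GLm p 2) : Mat p 2) =
      !![(a : Mat p 2) 0 0, (a : Mat p 2) 0 1;
        (b : Mat p 2) 1 0 * (a : Mat p 2) 0 0,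
        (a : Mat p 2) 0 1 * (b : Mat p 2) 1 0 + (b : Mat p 2) 1 1] := by
  rw [Units.val_mul]
  ext i j
  fin_cases i <;> fin_cases j <;>
    simp [Matrix.mul_apply, Fin.sum_univ_two, ha10, ha11, hb01, hb00, mul_comm]

/-- **Support transfer.**  If `K₁ ⊇ U⁺`, `K₂ ⊇ U⁻` and the four grid points `diag(ε,δ)`,
`ε ∈ {1,e}`, `δ ∈ {1,d}`, are products `a·b ∈ K₁·K₂`, then every corner-cell product
`[[ε,x],[0,1]]·[[1,0],[y,δ]]` lies in `K₁·K₂`. -/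
theorem corner_support_transfer {K₁ K₂ : Subgroup (GLm p 2)} {e d : ZMod p} (he0 : e ≠ 0)
    (hd0 : d ≠ 0)
    (hU : ∀ u : GLm p 2, (u : Mat p 2) 1 0 = 0 → (u : Mat p 2) 0 0 = 1 → (u : Mat p 2) 1 1 = 1 →
      u ∈ K₁)
    (hL : ∀ v : GLm p 2, (v : Mat p 2) 0 1 = 0 → (v : Mat p 2) 0 0 = 1 → (v : Mat p 2) 1 1 = 1 →
      v ∈ K₂)
    (hgrid : ∀ ε δ : ZMod p, (ε = 1 ∨ ε = e) → (δ = 1 ∨ δ = d) →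
      ∃ a ∈ K₁, ∃ b ∈ K₂, ((a * b : GLm p 2) : Mat p 2) = !![ε, 0; 0, δ])
    (lam : GLm p 2 → ℂ)
    (hsupp : ∀ g, lam g ≠ 0 → ∃ a b : GLm p 2, g = a * b ∧
        (a : Mat p 2) 1 0 = 0 ∧ (a : Mat p 2) 1 1 = 1 ∧
        ((a : Mat p 2) 0 0 = 1 ∨ (a : Mat p 2) 0 0 = e) ∧
        (b : Mat p 2) 0 1 = 0 ∧ (b : Mat p 2) 0 0 = 1 ∧
        ((b : Mat p 2) 1 1 = 1 ∨ (b : Mat p 2) 1 1 = d)) :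
    ∀ g, lam g ≠ 0 → ∃ a ∈ K₁, ∃ b ∈ K₂, g = a * b := by
  intro g hg
  obtain ⟨a, b, hab, ha10, ha11, ha00, hb01, hb00, hb11⟩ := hsupp g hg
  have hε : (a : Mat p 2) 0 0 ≠ 0 := by
    rcases ha00 with h | h <;> rw [h]
    · exact one_ne_zero
    · exact he0
  have hδ : (b : Mat p 2) 1 1 ≠ 0 := by
    rcases hb11 with h | h <;> rw [h]
    · exact one_ne_zero
    · exact hd0
  have hcoe := coe_mul_eq_corner ha10 ha11 hb01 hb00
  rw [← hab] at hcoe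
  obtain ⟨u, t, v, hg, hu10, hu00, hu11, ht, hv01, hv00, hv11⟩ := exists_factor_cell hε hδ hcoe
  obtain ⟨a', ha', b', hb', hab'⟩ := hgrid _ _ ha00 hb11
  have ht' : t = a' * b' := Units.ext (ht.trans hab'.symm)
  refine ⟨u * a', K₁.mul_mem (hU u hu10 hu00 hu11) ha', b' * v,
    K₂.mul_mem hb' (hL v hv01 hv00 hv11), ?_⟩
  rw [hg, ht']; group

/-- **Support transfer, reversed products** (`K₁ ⊇ U⁻` first, `K₂ ⊇ U⁺` second). -/
theorem corner_support_transfer_rev {K₁ K₂ : Subgroup (GLm p 2)} {e d : ZMod p} (he0 : e ≠ 0)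
    (hd0 : d ≠ 0)
    (hL : ∀ v : GLm p 2, (v : Mat p 2) 0 1 = 0 → (v : Mat p 2) 0 0 = 1 → (v : Mat p 2) 1 1 = 1 →
      v ∈ K₁)
    (hU : ∀ u : GLm p 2, (u : Mat p 2) 1 0 = 0 → (u : Mat p 2) 0 0 = 1 → (u : Mat p 2) 1 1 = 1 →
      u ∈ K₂)
    (hgrid : ∀ ε δ : ZMod p, (ε = 1 ∨ ε = e) → (δ = 1 ∨ δ = d) →
      ∃ b ∈ K₁, ∃ a ∈ K₂, ((b * a : GLm p 2) : Mat p 2) = !![ε, 0; 0, δ])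
    (lam : GLm p 2 → ℂ)
    (hsupp : ∀ g, lam g ≠ 0 → ∃ b a : GLm p 2, g = b * a ∧
        (b : Mat p 2) 0 1 = 0 ∧ (b : Mat p 2) 0 0 = 1 ∧
        ((b : Mat p 2) 1 1 = 1 ∨ (b : Mat p 2) 1 1 = d) ∧
        (a : Mat p 2) 1 0 = 0 ∧ (a : Mat p 2) 1 1 = 1 ∧
        ((a : Mat p 2) 0 0 = 1 ∨ (a : Mat p 2) 0 0 = e)) :
    ∀ g, lam g ≠ 0 → ∃ b ∈ K₁, ∃ a ∈ K₂, g = b * a := by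
  intro g hg
  obtain ⟨b, a, hba, hb01, hb00, hb11, ha10, ha11, ha00⟩ := hsupp g hg
  have hε : (a : Mat p 2) 0 0 ≠ 0 := by
    rcases ha00 with h | h <;> rw [h]
    · exact one_ne_zero
    · exact he0
  have hδ : (b : Mat p 2) 1 1 ≠ 0 := by
    rcases hb11 with h | h <;> rw [h]
    · exact one_ne_zero
    · exact hd0
  have hcoe := coe_mul_eq_corner_rev hb01 hb00 ha10 ha11
  rw [← hba] at hcoe
  obtain ⟨v, t, u, hg, hv01, hv00, hv11, ht, hu10, hu00, hu11⟩ :=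
    exists_factor_cell_rev hε hδ hcoe
  obtain ⟨b', hb', a', ha', hba'⟩ := hgrid _ _ ha00 hb11
  have ht' : t = b' * a' := Units.ext (ht.trans hba'.symm)
  refine ⟨v * b', K₁.mul_mem (hL v hv01 hv00 hv11) hb', a' * u,
    K₂.mul_mem ha' (hU u hu10 hu00 hu11), ?_⟩
  rw [hg, ht']; group

/-! ### The six placements -/

/-- **Grid theorem, `U⁺ ≤ H₁`, `U⁻ ≤ H₂`.**  If the grid `diag(ε,δ)`, `ε ∈ {1,e}`, `δ ∈ {1,d}`
(`e, d ∉ {0,1}`) lies in `H₁·H₂`, a subgroup-TPP triple `(H₁, H₂, H₃)` has no level-1 identity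
test. -/
theorem no_idTest_grid_up₁_lo₂ {H₁ H₂ H₃ : Subgroup (GLm p 2)} (htpp : SubgroupTPP H₁ H₂ H₃)
    {e d : ZMod p} (he0 : e ≠ 0) (he1 : e ≠ 1) (hd0 : d ≠ 0) (hd1 : d ≠ 1)
    (hU : ∀ u : GLm p 2, (u : Mat p 2) 1 0 = 0 → (u : Mat p 2) 0 0 = 1 → (u : Mat p 2) 1 1 = 1 →
      u ∈ H₁)
    (hL : ∀ v : GLm p 2, (v : Mat p 2) 0 1 = 0 → (v : Mat p 2) 0 0 = 1 → (v : Mat p 2) 1 1 = 1 →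
      v ∈ H₂)
    (hgrid : ∀ ε δ : ZMod p, (ε = 1 ∨ ε = e) → (δ = 1 ∨ δ = d) →
      ∃ a ∈ H₁, ∃ b ∈ H₂, ((a * b : GLm p 2) : Mat p 2) = !![ε, 0; 0, δ]) :
    ¬ ∃ f ∈ levelSubmodule p 2 1, f 1 = 1 ∧
      ∀ a ∈ H₁, ∀ b ∈ H₂, ∀ c ∈ H₃, a * b * c ≠ 1 → f (a * b * c) = 0 := by
  obtain ⟨lam, h1, hsupp, hann⟩ := exists_corner_annihilator he0 he1 hd0 hd1
  exact no_idTest_of_annihilator htpp lam h1 hann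
    (Or.inl (corner_support_transfer he0 hd0 hU hL hgrid lam hsupp))

/-- **Grid theorem, `U⁺ ≤ H₁`, `U⁻ ≤ H₃`.** -/
theorem no_idTest_grid_up₁_lo₃ {H₁ H₂ H₃ : Subgroup (GLm p 2)} (htpp : SubgroupTPP H₁ H₂ H₃)
    {e d : ZMod p} (he0 : e ≠ 0) (he1 : e ≠ 1) (hd0 : d ≠ 0) (hd1 : d ≠ 1)
    (hU : ∀ u : GLm p 2, (u : Mat p 2) 1 0 = 0 → (u : Mat p 2) 0 0 = 1 → (u : Mat p 2) 1 1 = 1 →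
      u ∈ H₁)
    (hL : ∀ v : GLm p 2, (v : Mat p 2) 0 1 = 0 → (v : Mat p 2) 0 0 = 1 → (v : Mat p 2) 1 1 = 1 →
      v ∈ H₃)
    (hgrid : ∀ ε δ : ZMod p, (ε = 1 ∨ ε = e) → (δ = 1 ∨ δ = d) →
      ∃ a ∈ H₁, ∃ b ∈ H₃, ((a * b : GLm p 2) : Mat p 2) = !![ε, 0; 0, δ]) :
    ¬ ∃ f ∈ levelSubmodule p 2 1, f 1 = 1 ∧
      ∀ a ∈ H₁, ∀ b ∈ H₂, ∀ c ∈ H₃, a * b * c ≠ 1 → f (a * b * c) = 0 := by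
  obtain ⟨lam, h1, hsupp, hann⟩ := exists_corner_annihilator he0 he1 hd0 hd1
  exact no_idTest_of_annihilator htpp lam h1 hann
    (Or.inr (Or.inl (corner_support_transfer he0 hd0 hU hL hgrid lam hsupp)))

/-- **Grid theorem, `U⁺ ≤ H₂`, `U⁻ ≤ H₃`.** -/
theorem no_idTest_grid_up₂_lo₃ {H₁ H₂ H₃ : Subgroup (GLm p 2)} (htpp : SubgroupTPP H₁ H₂ H₃)
    {e d : ZMod p} (he0 : e ≠ 0) (he1 : e ≠ 1) (hd0 : d ≠ 0) (hd1 : d ≠ 1)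
    (hU : ∀ u : GLm p 2, (u : Mat p 2) 1 0 = 0 → (u : Mat p 2) 0 0 = 1 → (u : Mat p 2) 1 1 = 1 →
      u ∈ H₂)
    (hL : ∀ v : GLm p 2, (v : Mat p 2) 0 1 = 0 → (v : Mat p 2) 0 0 = 1 → (v : Mat p 2) 1 1 = 1 →
      v ∈ H₃)
    (hgrid : ∀ ε δ : ZMod p, (ε = 1 ∨ ε = e) → (δ = 1 ∨ δ = d) →
      ∃ a ∈ H₂, ∃ b ∈ H₃, ((a * b : GLm p 2) : Mat p 2) = !![ε, 0; 0, δ]) :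
    ¬ ∃ f ∈ levelSubmodule p 2 1, f 1 = 1 ∧
      ∀ a ∈ H₁, ∀ b ∈ H₂, ∀ c ∈ H₃, a * b * c ≠ 1 → f (a * b * c) = 0 := by
  obtain ⟨lam, h1, hsupp, hann⟩ := exists_corner_annihilator he0 he1 hd0 hd1
  exact no_idTest_of_annihilator htpp lam h1 hann
    (Or.inr (Or.inr (corner_support_transfer he0 hd0 hU hL hgrid lam hsupp)))

/-- **Grid theorem, `U⁻ ≤ H₁`, `U⁺ ≤ H₂`** (reversed products). -/
theorem no_idTest_grid_lo₁_up₂ {H₁ H₂ H₃ : Subgroup (GLm p 2)} (htpp : SubgroupTPP H₁ H₂ H₃)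
    {e d : ZMod p} (he0 : e ≠ 0) (he1 : e ≠ 1) (hd0 : d ≠ 0) (hd1 : d ≠ 1)
    (hL : ∀ v : GLm p 2, (v : Mat p 2) 0 1 = 0 → (v : Mat p 2) 0 0 = 1 → (v : Mat p 2) 1 1 = 1 →
      v ∈ H₁)
    (hU : ∀ u : GLm p 2, (u : Mat p 2) 1 0 = 0 → (u : Mat p 2) 0 0 = 1 → (u : Mat p 2) 1 1 = 1 →
      u ∈ H₂)
    (hgrid : ∀ ε δ : ZMod p, (ε = 1 ∨ ε = e) → (δ = 1 ∨ δ = d) →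
      ∃ b ∈ H₁, ∃ a ∈ H₂, ((b * a : GLm p 2) : Mat p 2) = !![ε, 0; 0, δ]) :
    ¬ ∃ f ∈ levelSubmodule p 2 1, f 1 = 1 ∧
      ∀ a ∈ H₁, ∀ b ∈ H₂, ∀ c ∈ H₃, a * b * c ≠ 1 → f (a * b * c) = 0 := by
  obtain ⟨lam, h1, hsupp, hann⟩ := exists_corner_annihilator_rev he0 he1 hd0 hd1
  exact no_idTest_of_annihilator htpp lam h1 hann
    (Or.inl (corner_support_transfer_rev he0 hd0 hL hU hgrid lam hsupp))

/-- **Grid theorem, `U⁻ ≤ H₁`, `U⁺ ≤ H₃`** (reversed products). -/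
theorem no_idTest_grid_lo₁_up₃ {H₁ H₂ H₃ : Subgroup (GLm p 2)} (htpp : SubgroupTPP H₁ H₂ H₃)
    {e d : ZMod p} (he0 : e ≠ 0) (he1 : e ≠ 1) (hd0 : d ≠ 0) (hd1 : d ≠ 1)
    (hL : ∀ v : GLm p 2, (v : Mat p 2) 0 1 = 0 → (v : Mat p 2) 0 0 = 1 → (v : Mat p 2) 1 1 = 1 →
      v ∈ H₁)
    (hU : ∀ u : GLm p 2, (u : Mat p 2) 1 0 = 0 → (u : Mat p 2) 0 0 = 1 → (u : Mat p 2) 1 1 = 1 →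
      u ∈ H₃)
    (hgrid : ∀ ε δ : ZMod p, (ε = 1 ∨ ε = e) → (δ = 1 ∨ δ = d) →
      ∃ b ∈ H₁, ∃ a ∈ H₃, ((b * a : GLm p 2) : Mat p 2) = !![ε, 0; 0, δ]) :
    ¬ ∃ f ∈ levelSubmodule p 2 1, f 1 = 1 ∧
      ∀ a ∈ H₁, ∀ b ∈ H₂, ∀ c ∈ H₃, a * b * c ≠ 1 → f (a * b * c) = 0 := by
  obtain ⟨lam, h1, hsupp, hann⟩ := exists_corner_annihilator_rev he0 he1 hd0 hd1
  exact no_idTest_of_annihilator htpp lam h1 hann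
    (Or.inr (Or.inl (corner_support_transfer_rev he0 hd0 hL hU hgrid lam hsupp)))

/-- **Grid theorem, `U⁻ ≤ H₂`, `U⁺ ≤ H₃`** (reversed products). -/
theorem no_idTest_grid_lo₂_up₃ {H₁ H₂ H₃ : Subgroup (GLm p 2)} (htpp : SubgroupTPP H₁ H₂ H₃)
    {e d : ZMod p} (he0 : e ≠ 0) (he1 : e ≠ 1) (hd0 : d ≠ 0) (hd1 : d ≠ 1)
    (hL : ∀ v : GLm p 2, (v : Mat p 2) 0 1 = 0 → (v : Mat p 2) 0 0 = 1 → (v : Mat p 2) 1 1 = 1 →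
      v ∈ H₂)
    (hU : ∀ u : GLm p 2, (u : Mat p 2) 1 0 = 0 → (u : Mat p 2) 0 0 = 1 → (u : Mat p 2) 1 1 = 1 →
      u ∈ H₃)
    (hgrid : ∀ ε δ : ZMod p, (ε = 1 ∨ ε = e) → (δ = 1 ∨ δ = d) →
      ∃ b ∈ H₂, ∃ a ∈ H₃, ((b * a : GLm p 2) : Mat p 2) = !![ε, 0; 0, δ]) :
    ¬ ∃ f ∈ levelSubmodule p 2 1, f 1 = 1 ∧
      ∀ a ∈ H₁, ∀ b ∈ H₂, ∀ c ∈ H₃, a * b * c ≠ 1 → f (a * b * c) = 0 := by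
  obtain ⟨lam, h1, hsupp, hann⟩ := exists_corner_annihilator_rev he0 he1 hd0 hd1
  exact no_idTest_of_annihilator htpp lam h1 hann
    (Or.inr (Or.inr (corner_support_transfer_rev he0 hd0 hL hU hgrid lam hsupp)))

/-! ### Example family in crux vocabulary: `T₁ = ⟨diag(1,-1)⟩`, `T₂ = {±1}` -/

/-- **Mixed decorations.**  `p ≠ 2`; `K₁ ⊇ U⁺ ∪ {diag(1,-1)}`, `K₂ ⊇ U⁻ ∪ {-1}` (so neither member
need contain an opposite one-sided decoration, but `D = T₁T₂ ∋ diag(-1,1) = diag(1,-1)·(-1)`).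
Then no subgroup-TPP triple `(K₁, K₂, H₃)` carries the crux's identity design at level `1`. -/
theorem no_levelOne_design_mixed_frame (hp2 : p ≠ 2) {K₁ K₂ H₃ : Subgroup (GLm p 2)}
    (hU : ∀ u : GLm p 2, (u : Mat p 2) 1 0 = 0 → (u : Mat p 2) 0 0 = 1 → (u : Mat p 2) 1 1 = 1 →
      u ∈ K₁)
    (hs : ∀ s : GLm p 2, (s : Mat p 2) = !![1, 0; 0, -1] → s ∈ K₁)
    (hL : ∀ v : GLm p 2, (v : Mat p 2) 0 1 = 0 → (v : Mat p 2) 0 0 = 1 → (v : Mat p 2) 1 1 = 1 →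
      v ∈ K₂)
    (hz : ∀ z : GLm p 2, (z : Mat p 2) = !![-1, 0; 0, -1] → z ∈ K₂)
    (htpp : SubgroupTPP K₁ K₂ H₃) :
    ¬ ∃ c : Mat p 2 → ℂ, (∀ M, 1 < M.rank → c M = 0) ∧
      (∑ M, c M * ZMod.stdAddChar (Matrix.trace (M * ((1 : GLm p 2) : Mat p 2)))) = 1 ∧
      ∀ a ∈ K₁, ∀ b ∈ K₂, ∀ g ∈ H₃, a * b * g ≠ 1 →
        (∑ M, c M *
          ZMod.stdAddChar (Matrix.trace (M * ((a * b * g : GLm p 2) : Mat p 2)))) = 0 := by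
  have hchar : ringChar (ZMod p) ≠ 2 := by rw [ZMod.ringChar_zmod_n]; exact hp2
  have hne1 : (-1 : ZMod p) ≠ 1 := Ring.neg_one_ne_one_of_char_ne_two hchar
  have hne0 : (-1 : ZMod p) ≠ 0 := neg_ne_zero.mpr one_ne_zero
  obtain ⟨s, hs'⟩ : ∃ s : GLm p 2, (s : Mat p 2) = !![1, 0; 0, -1] :=
    ⟨Matrix.GeneralLinearGroup.mkOfDetNeZero _ (by rw [Matrix.det_fin_two_of]; simp), rfl⟩
  obtain ⟨z, hz'⟩ : ∃ z : GLm p 2, (z : Mat p 2) = !![-1, 0; 0, -1] :=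
    ⟨Matrix.GeneralLinearGroup.mkOfDetNeZero _ (by rw [Matrix.det_fin_two_of]; simp), rfl⟩
  have hgrid : ∀ ε δ : ZMod p, (ε = 1 ∨ ε = -1) → (δ = 1 ∨ δ = -1) →
      ∃ a ∈ K₁, ∃ b ∈ K₂, ((a * b : GLm p 2) : Mat p 2) = !![ε, 0; 0, δ] := by
    rintro ε δ (rfl | rfl) (rfl | rfl)
    · refine ⟨1, K₁.one_mem, 1, K₂.one_mem, ?_⟩
      rw [mul_one, Units.val_one]; ext i j; fin_cases i <;> fin_cases j <;> simp
    · refine ⟨s, hs s hs', 1, K₂.one_mem, ?_⟩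
      rw [mul_one, hs']
    · refine ⟨s, hs s hs', z, hz z hz', ?_⟩
      rw [Units.val_mul, hs', hz', Matrix.mul_fin_two]
      ext i j; fin_cases i <;> fin_cases j <;> simp
    · refine ⟨1, K₁.one_mem, z, hz z hz', ?_⟩
      rw [one_mul, hz']
  rintro ⟨c, hc, hc1, hc0⟩
  exact no_idTest_grid_up₁_lo₂ htpp hne0 hne1 hne0 hne1 hU hL hgrid
    ⟨fourierFn c, LevelOneGL2Designs.Negative.fourierFn_mem_levelSubmodule hc, hc1,
      fun a ha b hb g hg hne => hc0 a ha b hb g hg hne⟩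

end CornerGrid

end Summit.MatrixMultiplication.MatrixMultiplication.Theorems.SubgroupIdentityDesigns.Negative

end
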